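import Mathlib

/-!
# The derivative twist: `Fil_{k+1} / Fil_0 ≅ Fil_k ⊗ ω⁻¹` for polynomial functions on the affine line

Solo-informed programme (Langlands / W4 Eisenstein corner), session 25, §7.11 (16.11)(g)(★7) (THEOREM E):
let `P = 𝔽_p[t]_{≤ p-1}` be the functions on the affine line over `𝔽_p` with the affine group acting by
substitution `f ↦ f(a t + b)`, and `Fil_k` = polynomials of degree `≤ k`.  The derivative `f ↦ f'`
satisfies `(f(a t + b))' = a · f'(a t + b)` — it is equivariant up to the character `(a, b) ↦ a`,
i.e. up to `ω⁻¹` on the Kummer side —, kills exactly the constants in degrees `< p`, does not raise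
the degree filtration, and hits every polynomial of degree `≤ k` from one of degree `≤ k + 1` as long
as `k + 1 < p`.  Together: `Fil_{k+1}/Fil_0 ≅ Fil_k ⊗ ω⁻¹` equivariantly (used for the canonical
class `ξ_η = [Fil_3^*]` at `p = 5`, `k = 2`).  The four statements below are exactly these four facts,
over an arbitrary commutative ring / a ring of characteristic `p` without zero divisors / a field of
characteristic `p`.
-/

open Polynomial

namespace Summit.Langlands.Langlands.Theorems

/-- Equivariance up to the twist: `(f ∘ (aX+b))' = a · (f' ∘ (aX+b))`. -/
theorem soloInformed_derivative_comp_affine {R : Type*} [CommRing R] (f : R[X]) (a b : R) :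
    derivative (f.comp (C a * X + C b)) = C a * (derivative f).comp (C a * X + C b) := by
  rw [derivative_comp]
  simp

/-- The affine substitution does not raise the degree filtration. -/
theorem soloInformed_natDegree_comp_affine_le {R : Type*} [CommRing R] (f : R[X]) (a b : R) :
    (f.comp (C a * X + C b)).natDegree ≤ f.natDegree := by
  refine natDegree_comp_le.trans ?_
  calc f.natDegree * (C a * X + C b).natDegree ≤ f.natDegree * 1 :=
        Nat.mul_le_mul_left _ natDegree_linear_le
    _ = f.natDegree := Nat.mul_one _

/-- In characteristic `p`, a polynomial of degree `< p` with zero derivative is constant: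
the kernel of the derivative on `Fil_{p-1}` is `Fil_0`. -/
theorem soloInformed_eq_C_of_derivative_eq_zero {R : Type*} [CommRing R] [NoZeroDivisors R]
    (p : ℕ) [Fact p.Prime] [CharP R p] (f : R[X]) (hdeg : f.natDegree < p)
    (hf : derivative f = 0) : f = C (f.coeff 0) := by
  ext n
  rcases n with _ | n
  · simp
  · rw [coeff_C, if_neg (Nat.succ_ne_zero n)]
    by_cases hn : n + 1 ≤ f.natDegree
    · have h1 : f.coeff (n + 1) * ((n : R) + 1) = 0 := by
        have := congrArg (fun q => q.coeff n) hf
        simpa [coeff_derivative] using this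
      have hne : ((n : R) + 1) ≠ 0 := by
        have hlt : n + 1 < p := lt_of_le_of_lt hn hdeg
        intro h0
        have hcast : ((n + 1 : ℕ) : R) = 0 := by exact_mod_cast h0
        rw [CharP.cast_eq_zero_iff R p] at hcast
        exact absurd (Nat.le_of_dvd (Nat.succ_pos n) hcast) (not_le.mpr hlt)
      rcases mul_eq_zero.mp h1 with h | h
      · exact h
      · exact absurd h hne
    · exact coeff_eq_zero_of_natDegree_lt (not_le.mp hn)

/-- Surjectivity onto `Fil_k` from `Fil_{k+1}` when `k + 1 < p`: every `g` of degree `≤ k` is the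
derivative of an explicit `f` of degree `≤ k + 1` (termwise antiderivative). -/
theorem soloInformed_exists_antiderivative {K : Type*} [Field K] (p : ℕ) [Fact p.Prime]
    [CharP K p] (k : ℕ) (hk : k + 1 < p) (g : K[X]) (hg : g.natDegree ≤ k) :
    ∃ f : K[X], f.natDegree ≤ k + 1 ∧ derivative f = g := by
  -- the termwise antiderivative
  have hne : ∀ i ∈ Finset.range (k + 1), ((i : K) + 1) ≠ 0 := by
    intro i hi h0
    have hlt : i + 1 < p := by
      have := Finset.mem_range.mp hi
      omega
    have hcast : ((i + 1 : ℕ) : K) = 0 := by exact_mod_cast h0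
    rw [CharP.cast_eq_zero_iff K p] at hcast
    exact absurd (Nat.le_of_dvd (Nat.succ_pos i) hcast) (not_le.mpr hlt)
  refine ⟨∑ i ∈ Finset.range (k + 1), C (g.coeff i / ((i : K) + 1)) * X ^ (i + 1), ?_, ?_⟩
  · refine natDegree_sum_le_of_forall_le _ _ ?_
    intro i hi
    refine natDegree_C_mul_X_pow_le _ _ |>.trans ?_
    have := Finset.mem_range.mp hi
    omega
  · have hterm : ∀ i ∈ Finset.range (k + 1),
        derivative (C (g.coeff i / ((i : K) + 1)) * X ^ (i + 1)) = C (g.coeff i) * X ^ i := by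
      intro i hi
      rw [derivative_C_mul_X_pow]
      congr 2
      · push_cast
        rw [div_mul_cancel₀ _ (hne i hi)]
    rw [derivative_sum, Finset.sum_congr rfl hterm]
    ext n
    rw [finsetSum_coeff]
    simp only [coeff_C_mul_X_pow]
    rw [Finset.sum_ite_eq]
    split_ifs with hn
    · rfl
    · rw [Finset.mem_range, not_lt] at hn
      exact (coeff_eq_zero_of_natDegree_lt (lt_of_le_of_lt hg (by omega))).symm

end Summit.Langlands.Langlands.Theorems
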